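import Mathlib
import HarnessLib
import Summits.ValiantsHypothesis.ValiantsHypothesis.Theses.MonotoneRestoration
import Literature.Computability.AlgebraicComplexity.ArithCircuit
import Literature.Computability.AlgebraicComplexity.ArithCircuitProofs
import Literature.Computability.AlgebraicComplexity.MonotoneStructure
import Literature.Computability.AlgebraicComplexity.PermanentIrreducible
import Literature.ModelTheory.FiniteModelTheory.CkEquiv
import Summits.ValiantsHypothesis.ValiantsHypothesis.Theorems.MonotoneRestorationMonotoneRestorationQPCosetCount
import Summits.ValiantsHypothesis.ValiantsHypothesis.Theorems.MonotoneRestorationMonotoneRestorationQPSymmetricLB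
import Summits.ValiantsHypothesis.ValiantsHypothesis.Theorems.MonotoneRestorationMonotoneRestorationQPSupportSymmetrisation
import Summits.ValiantsHypothesis.ValiantsHypothesis.Theorems.MonotoneRestorationMonotoneRestorationQPSparseRegime
import Summits.ValiantsHypothesis.ValiantsHypothesis.Theorems.MonotoneRestorationMonotoneRestorationQPBeta
import Literature.Computability.AlgebraicComplexity.SymmetricArithCircuit
import Literature.Computability.AlgebraicComplexity.DawarWilsenach2025Proofs
import Literature.GroupTheory.PermutationGroups.SmallIndexSubgroups
import Summits.ValiantsHypothesis.ValiantsHypothesis.Theorems.MonotoneRestorationQP.Negative.LoadBearing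
import Summits.ValiantsHypothesis.ValiantsHypothesis.Theorems.MonotoneRestorationMonotoneRestorationQPPermSupportCount

/-! # TTRL-lite variant V18922 of `MonotoneRestorationQP` / `stub_mulGate_children_extend` (stmt-ValiantsHypothesis-15886)

Machine-generated helper (proved); move `lemma_proposal`, op `llm`: MvPolynomial over NNReal has no zero divisors (support_nonempty + add_mem_support_mul); needed to know the cofactor of a child is nonzero.
See docs/architecture/ttrl-lite.md. -/

namespace Summit.ValiantsHypothesis.ValiantsHypothesis.Theorems

open Summit.ValiantsHypothesis.ValiantsHypothesis.Theses.MonotoneRestoration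
open Literature.Computability.AlgebraicComplexity

/-- TTRL-lite variant V18922 (lemma_proposal `llm`) of `stub_mulGate_children_extend` (stmt-ValiantsHypothesis-15886); machine-found, kernel-checked. -/
theorem stub_mulGate_children_extend_var18922 :
    ∀ (n : ℕ) (p q : MvPolynomial (Fin n × Fin n) NNReal), p ≠ 0 → q ≠ 0 → p * q ≠ 0 := by
  intros
  positivity

end Summit.ValiantsHypothesis.ValiantsHypothesis.Theorems
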